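import Literature.Claims.NS.ClayPeriodicPressureBridge
import Literature.Analysis.FluidPDE.NSLerayHopf
import Literature.Analysis.FluidPDE.TaoClassGlobal
import Literature.Analysis.FluidPDE.ClassicalSolutionTorusProofs
import Literature.Analysis.FunctionSpaces.FlatTorusProofs
import Literature.Analysis.FunctionSpaces.TorusClassicalNSUniqueness
import Literature.Analysis.FunctionSpaces.TorusHolderBridge
import HarnessLib

/-!
# Clay (B)/(D): a periodic blow-up certificate on `[0,T)` excludes Clay-sense solvability

Reference file of the D-0090 «where NS proofs break» sweep (cell `ns-claims`), companion of
`Literature/Claims/NS/ClayVariants.lean` and `ClayPeriodicPressureBridge.lean` (same namespace). It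
lands the Δ6 bookkeeping «blow-up criterion ⇒ literal non-existence of a global smooth solution» for
the UNFORCED PERIODIC problem, in the form negative-direction papers use it (Tao 2013, Prop. 1.7 and §2:
smooth periodic solutions are unique up to the Galilean frame freedom, which the normalised/periodic
pressure removes): if the datum `u₀` launches a classical solution on `ℝ³ × [0,T)` with `u(·,t)` AND
`p(·,t)` `ℤ³`-periodic whose velocity gradient is not integrable in time,
`∫₀^T ‖∇u(·,t)‖_{L^∞} dt = ∞` (the Beale–Kato–Majda / Prodi–Serrin-type certificate that the
solution does not continue smoothly past `T`), then the Cauchy problem `(ν, f ≡ 0, u₀)` has NO solution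
smooth on `ℝ³ × [0,∞)` with `u(·,t)` periodic — printed condition (10) — and a fortiori none with
`u`, `p` periodic (errata).

Proof (all ingredients theorems of the tree): a printed-class global solution is boosted to one with
periodic pressure and the same datum (`IsNavierStokesSolution.exists_pressurePeriodic_of_velocityPeriodic_zero`,
Tao Lemma 4.1 (ii)); both it and the certificate solution descend to classical solutions on the flat
torus `𝕋³` (`IsClassicalNSSolutionOn.to_torus_holds` after `congr_slices`/`lift_descend`), where
classical solutions are unique (`Torus.IsClassicalNSSolutionOn.velocity_unique`, Majda–Bertozzi
Cor. 3.1), so the two velocities agree on `[0,T)`; but the global one has `‖∇u‖` bounded on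
`[0,T] × ℝ³` (joint smoothness + periodicity), contradicting the certificate.

* `torus_descend_classical_periodic`, `torus_velocity_eq_on_Ico`, `exists_norm_fderiv_lift_le_of_global`
  — the three bookkeeping lemmas;
* `not_clayPeriodic_solvable_of_blowupCertificate` — the statement above (printed class);
  `not_clayPeriodicErrata_solvable_of_blowupCertificate` — errata class;
* `navierStokesBreakdownPeriodic_of_blowupCertificate` — hence ONE such certificate at ONE viscosity
  proves Clay (D) as printed (`navierStokesBreakdownPeriodic_of_not_errataSolvable_zero`, Δ7 scaling).

(The `2π`-periodic instance for claim C12 is `Summit…Theorems.Shahmurov2026b.continuationBridge_holds`,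
which rescales to period `1` first; this file is the period-`1` Clay-schema form for reuse by every
periodic negative-direction skeleton.)

## References
* [Tao2013Localisation] T. Tao, *Localisation and compactness properties of the Navier–Stokes global
  regularity problem*, Anal. PDE 6 (2013), arXiv:1108.1165: Prop. 1.7, §2, Lemma 4.1 (ii).
* [MajdaBertozziCUP2002] A. Majda, A. Bertozzi, *Vorticity and Incompressible Flow*, CUP 2002, Cor. 3.1.
* [FeffermanClay2006] C. L. Fefferman, CMI problem description: (B), (D), (10), (11) p. 2; errata.

WHAT THIS IS NOT: not a claim about NS regularity or blow-up; not a claim about any author beyond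
the typed locator.
-/

open scoped ContDiff ENNReal Topology

namespace Literature.Claims.NS.ClayVariants

open Set Filter MeasureTheory Function Literature.Analysis Literature.Analysis.FluidPDE
  Literature.Analysis.FunctionSpaces

noncomputable section

/-- **Descent of a space-periodic classical solution to the flat torus.** A classical solution of the
unforced Navier–Stokes system on `ℝ³ × S` whose velocity and pressure slices are `ℤ³`-periodic for
`t ∈ S` is, read through `Torus.repr`, a classical solution on `𝕋³ × S`, and its velocity slices are
the lifts of the descended ones (Fefferman (8)/(10): periodic problems live on `ℝ³/ℤ³`).
[cite: FeffermanClay2006, (8) (10) p. 2] -/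
theorem torus_descend_classical_periodic {S : Set ℝ} {ν : ℝ}
    {u : ℝ → EuclideanSpace ℝ (Fin 3) → EuclideanSpace ℝ (Fin 3)} {p : ℝ → EuclideanSpace ℝ (Fin 3) → ℝ}
    (hcl : FluidPDE.IsClassicalNSSolutionOn S ν 0 u p)
    (hper : ∀ t ∈ S, IsLatticePeriodic (u t) ∧ IsLatticePeriodic (p t)) :
    Torus.IsClassicalNSSolutionOn S ν 0 (fun t x => u t (Torus.repr x)) (fun t x => p t (Torus.repr x)) ∧
      ∀ t ∈ S, Torus.lift (fun x => u t (Torus.repr x)) = u t := by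
  have hvU : ∀ t ∈ S, (fun s => Torus.lift (fun x => u s (Torus.repr x))) t = u t := fun t ht =>
    Torus.lift_descend_holds (u t) (hper t ht).1
  have hqP : ∀ t ∈ S, (fun s => Torus.lift (fun x => p s (Torus.repr x))) t = p t := fun t ht =>
    Torus.lift_descend_holds (p t) (hper t ht).2
  have hcl' : FluidPDE.IsClassicalNSSolutionOn S ν
      (fun t => Torus.lift ((0 : ℝ → UnitAddTorus (Fin 3) → EuclideanSpace ℝ (Fin 3)) t))
      (fun t => Torus.lift (fun x => u t (Torus.repr x))) (fun t => Torus.lift (fun x => p t (Torus.repr x))) := by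
    have h0 : (fun t => Torus.lift ((0 : ℝ → UnitAddTorus (Fin 3) → EuclideanSpace ℝ (Fin 3)) t)) =
        (0 : ℝ → EuclideanSpace ℝ (Fin 3) → EuclideanSpace ℝ (Fin 3)) := rfl
    rw [h0]
    exact hcl.congr_slices hvU hqP
  exact ⟨IsClassicalNSSolutionOn.to_torus_holds hcl', hvU⟩

/-- **Uniqueness on a half-open interval of regularity, on the torus**: a classical solution on
`𝕋³ × [0,T)` and a global one with the same datum agree on `[0,T)` (Majda–Bertozzi Cor. 3.1 on each
`[0,t]`, tree `Torus.IsClassicalNSSolutionOn.velocity_unique`). [cite: MajdaBertozziCUP2002, Cor. 3.1] -/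
theorem torus_velocity_eq_on_Ico {ν : ℝ} (hν : 0 ≤ ν) {T : ℝ}
    {U₁ U₂ : ℝ → UnitAddTorus (Fin 3) → EuclideanSpace ℝ (Fin 3)} {P₁ P₂ : ℝ → UnitAddTorus (Fin 3) → ℝ}
    (h₁ : Torus.IsClassicalNSSolutionOn (Ico 0 T) ν 0 U₁ P₁)
    (h₂ : Torus.IsClassicalNSSolutionOn (Ici 0) ν 0 U₂ P₂) (h0 : U₁ 0 = U₂ 0) :
    ∀ t ∈ Ico 0 T, U₁ t = U₂ t := by
  intro t ht
  rcases eq_or_lt_of_le ht.1 with h | h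
  · rw [← h]; exact h0
  exact Torus.IsClassicalNSSolutionOn.velocity_unique hν (h₁.mono (Icc_subset_Ico_right ht.2)
    (uniqueDiffOn_Icc h)) (h₂.mono Icc_subset_Ici_self (uniqueDiffOn_Icc h)) h0 ⟨h.le, le_rfl⟩

/-- **A global classical solution on the torus has `‖∇u‖` bounded on `[0,T] × ℝ³`** (read on the periodic
lift; joint smoothness on the compact `[0,T] × 𝕋³` — the «a priori bound on ∇u on compact time
intervals» half of the continuation dichotomy). [cite: Tao2013Localisation, §2 (smooth periodic solutions, H¹⁰ a priori bounds on compact time intervals)] -/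
theorem exists_norm_fderiv_lift_le_of_global {ν : ℝ} {U : ℝ → UnitAddTorus (Fin 3) → EuclideanSpace ℝ (Fin 3)}
    {P : ℝ → UnitAddTorus (Fin 3) → ℝ} (h : Torus.IsClassicalNSSolutionOn (Ici 0) ν 0 U P) (T : ℝ) :
    ∃ D : ℝ, ∀ t ∈ Icc 0 T, ∀ y : EuclideanSpace ℝ (Fin 3), ‖fderiv ℝ (Torus.lift (U t)) y‖ ≤ D := by
  have hS : UniqueDiffOn ℝ (Ici (0 : ℝ)) := uniqueDiffOn_Ici 0
  have hb : ∀ i : Fin 3, ∃ C : ℝ, ∀ t ∈ Icc 0 T, ∀ x, ‖Torus.partialDeriv i (U t) x‖ ≤ C := fun i =>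
    (h.smooth_velocity.partialDeriv hS i).exists_norm_le_of_isCompact isCompact_Icc Icc_subset_Ici_self
  choose C hC using hb
  refine ⟨∑ i, C i, fun t ht y => ?_⟩
  exact Torus.norm_fderiv_lift_le_of_norm_partialDeriv_le
    ((h.smooth_velocity.isSmooth_slice (Icc_subset_Ici_self ht)).isContDiff (n := 1) (by simp))
    (fun i x => hC i t ht x) y

/-- **A periodic blow-up certificate on `[0,T)` excludes printed-(10) solvability** (Tao 2013 Prop. 1.7
/ §2; Δ6 of the `ClayVariants` docstring for the unforced periodic problem): if a classical solution
`(u, p)` of the unforced equations on `ℝ³ × [0,T)` with `u(0) = u₀`, `u(·,t)` and `p(·,t)`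
`ℤ³`-periodic for `t ∈ [0,T)`, has `∫₀^T ‖∇u(·,t)‖_{L^∞} dt = ∞` (lower integral of the `[0,∞]`-valued
supremum of the operator norm of `∇u`), then `(ν, 0, u₀)` has no solution smooth on `ℝ³ × [0,∞)` with
periodic velocity. [cite: Tao2013Localisation, Prop. 1.7 and §2] [cite: FeffermanClay2006, (D) with (10) (11) p. 2] -/
theorem not_clayPeriodic_solvable_of_blowupCertificate {ν T : ℝ} (hν : 0 ≤ ν)
    {u₀ : EuclideanSpace ℝ (Fin 3) → EuclideanSpace ℝ (Fin 3)}
    {u : ℝ → EuclideanSpace ℝ (Fin 3) → EuclideanSpace ℝ (Fin 3)} {p : ℝ → EuclideanSpace ℝ (Fin 3) → ℝ}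
    (hcl : FluidPDE.IsClassicalNSSolutionOn (Ico 0 T) ν 0 u p) (hu0 : u 0 = u₀)
    (hper : ∀ t ∈ Ico 0 T, IsLatticePeriodic (u t) ∧ IsLatticePeriodic (p t))
    (hblow : (∫⁻ t in Ioo 0 T, ⨆ x : EuclideanSpace ℝ (Fin 3), ‖fderiv ℝ (u t) x‖ₑ) = ⊤) :
    ¬ clayPeriodic.Solvable ν 0 u₀ := by
  rintro ⟨v, q, hvs, hqs, hns, hvper⟩
  -- normalise the pressure of the global solution (Galilean boost fixing the datum)
  obtain ⟨w, r, hws, hrs, hnsw, hwper⟩ :=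
    hns.exists_pressurePeriodic_of_velocityPeriodic_zero hvs hqs hvper
  have hclw : FluidPDE.IsClassicalNSSolutionOn (Ici 0) ν 0 w r :=
    (isNavierStokesSolution_and_smooth_iff.1 ⟨hnsw, hws, hrs⟩).1
  -- descend both and compare on the torus
  obtain ⟨hU₁, hlift₁⟩ := torus_descend_classical_periodic hcl hper
  obtain ⟨hU₂, -⟩ := torus_descend_classical_periodic hclw fun t ht => hwper t ht
  have h0 : (fun (t : ℝ) (x : UnitAddTorus (Fin 3)) => u t (Torus.repr x)) 0 =
      (fun (t : ℝ) (x : UnitAddTorus (Fin 3)) => w t (Torus.repr x)) 0 := by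
    funext x
    show u 0 (Torus.repr x) = w 0 (Torus.repr x)
    rw [hu0, hnsw.initial]
  have heq := torus_velocity_eq_on_Ico hν hU₁ hU₂ h0
  -- bounded gradient on `[0,T)`
  obtain ⟨D, hD⟩ := exists_norm_fderiv_lift_le_of_global hU₂ T
  have hgrad : ∀ s ∈ Ico 0 T, ∀ y, ‖fderiv ℝ (u s) y‖ ≤ D := by
    intro s hs y
    rw [← hlift₁ s hs, heq s hs]
    exact hD s (Ico_subset_Icc_self hs) y
  -- hence the certificate integral is finite
  have hfin : (∫⁻ t in Ioo 0 T, ⨆ x : EuclideanSpace ℝ (Fin 3), ‖fderiv ℝ (u t) x‖ₑ) < ⊤ := by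
    have hle : ∀ t ∈ Ioo 0 T, (⨆ x : EuclideanSpace ℝ (Fin 3), ‖fderiv ℝ (u t) x‖ₑ) ≤
        ENNReal.ofReal D := fun t ht =>
      iSup_le fun x => by
        rw [← ofReal_norm]
        exact ENNReal.ofReal_le_ofReal (hgrad t (Ioo_subset_Ico_self ht) x)
    calc (∫⁻ t in Ioo 0 T, ⨆ x : EuclideanSpace ℝ (Fin 3), ‖fderiv ℝ (u t) x‖ₑ)
        ≤ ∫⁻ _ in Ioo 0 T, ENNReal.ofReal D := setLIntegral_mono measurable_const hle
      _ = ENNReal.ofReal D * volume (Ioo 0 T) := setLIntegral_const _ _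
      _ < ⊤ := ENNReal.mul_lt_top ENNReal.ofReal_lt_top (by simp [Real.volume_Ioo])
  exact hfin.ne hblow

/-- The same certificate excludes errata-class solvability (both `u`, `p` periodic) — the weaker
conclusion, immediate from the printed one. [cite: FeffermanClay2006, (D) p. 2 and errata] -/
theorem not_clayPeriodicErrata_solvable_of_blowupCertificate {ν T : ℝ} (hν : 0 ≤ ν)
    {u₀ : EuclideanSpace ℝ (Fin 3) → EuclideanSpace ℝ (Fin 3)}
    {u : ℝ → EuclideanSpace ℝ (Fin 3) → EuclideanSpace ℝ (Fin 3)} {p : ℝ → EuclideanSpace ℝ (Fin 3) → ℝ}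
    (hcl : FluidPDE.IsClassicalNSSolutionOn (Ico 0 T) ν 0 u p) (hu0 : u 0 = u₀)
    (hper : ∀ t ∈ Ico 0 T, IsLatticePeriodic (u t) ∧ IsLatticePeriodic (p t))
    (hblow : (∫⁻ t in Ioo 0 T, ⨆ x : EuclideanSpace ℝ (Fin 3), ‖fderiv ℝ (u t) x‖ₑ) = ⊤) :
    ¬ clayPeriodicErrata.Solvable ν 0 u₀ := fun h =>
  not_clayPeriodic_solvable_of_blowupCertificate hν hcl hu0 hper hblow
    ((clayPeriodic_solvable_zero_iff_errata ν u₀).2 h)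

/-- **One periodic blow-up certificate at one viscosity `ν > 0` proves Clay (D) as printed** (the leaf
`NavierStokesBreakdownPeriodic`, at every viscosity, via the Δ7 scaling): the datum must be smooth,
divergence free and `ℤ³`-periodic. [cite: Tao2013Localisation, Prop. 1.7 and Rem. 1.2] [cite: FeffermanClay2006, (D) p. 2] -/
theorem navierStokesBreakdownPeriodic_of_blowupCertificate {ν T : ℝ} (hν : 0 < ν)
    {u₀ : EuclideanSpace ℝ (Fin 3) → EuclideanSpace ℝ (Fin 3)} (hu₀ : ContDiff ℝ ∞ u₀)
    (hdiv : NSWave0.IsDivFree u₀) (hper₀ : IsLatticePeriodic u₀)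
    {u : ℝ → EuclideanSpace ℝ (Fin 3) → EuclideanSpace ℝ (Fin 3)} {p : ℝ → EuclideanSpace ℝ (Fin 3) → ℝ}
    (hcl : FluidPDE.IsClassicalNSSolutionOn (Ico 0 T) ν 0 u p) (hu0 : u 0 = u₀)
    (hper : ∀ t ∈ Ico 0 T, IsLatticePeriodic (u t) ∧ IsLatticePeriodic (p t))
    (hblow : (∫⁻ t in Ioo 0 T, ⨆ x : EuclideanSpace ℝ (Fin 3), ‖fderiv ℝ (u t) x‖ₑ) = ⊤) :
    Summit.NavierStokesRegularity.NavierStokesRegularity.NavierStokesBreakdownPeriodic :=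
  navierStokesBreakdownPeriodic_of_not_errataSolvable_zero hν hu₀ hdiv hper₀
    (not_clayPeriodicErrata_solvable_of_blowupCertificate hν.le hcl hu0 hper hblow)

end

end Literature.Claims.NS.ClayVariants
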